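import Literature.MathematicalPhysics.QuantumLattice.HubbardTTPrimeGrandCanonicalPressure
import Literature.MathematicalPhysics.QuantumLattice.HubbardTTPrimeThermalPressureSpinSectorsConcave
import Literature.MathematicalPhysics.QuantumLattice.HubbardTTPrimeThermalPressureDensityAnchors
import HarnessLib

/-!
# The grand-canonical pressure of the 2D `t–t'` Hubbard model is the Legendre transform of the canonical
# `S^z = 0` pressure of record: `P(β; t,t',U; μ) = sup_{n ∈ [0,2)} [pressureTT' β t t' U n + βμn]`

Topic `MathematicalPhysics/QuantumLattice` (family `hubbard`); the junction of
`HubbardTTPrimeGrandCanonicalPressure.lean` (`L⁻² log Re Z_β(H_L − μN) → gcPressureTT' β t t' U μ =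
sup_{(x,y) ∈ [0,1)²} [p(x,y) + βμ(x+y)]`) and `HubbardTTPrimeThermalPressureSpinSectorsConcave.lean`
(`S^z = 0` dominance `p(x,y) ≤ pressureTT' β t t' U (x+y)`): the two-species supremum collapses onto the diagonal,
so the grand-canonical pressure is the ONE-VARIABLE Legendre transform of the canonical number of record
`pressureTT'` — equivalence of the canonical (`S^z = 0` sector, the thermal convention of the programme) and the
grand-canonical ensembles at every temperature.

* `gcPressureTT'_le_iff_pressureTT'` — `P(μ) ≤ q ↔ ∀ n ∈ [0,2), pressureTT' n + βμn ≤ q`;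
* `gcPressureTT'_eq_sSup_pressureTT'` — `P(μ) = sup_{n ∈ [0,2)} [pressureTT' n + βμn]`, `isLUB_gcPressureTT'`;
* `exists_pressureTT'_add_gt_of_lt_gcPressureTT'` — every `W < P(μ)` is beaten by some density:
  `∃ n ∈ [0,2), W < pressureTT' n + βμn` (how a certified grand-canonical FLOOR becomes canonical information);
* `pressureTT'_le_gcPressureTT'_sub` — `pressureTT' n ≤ P(μ) − βμn` for every `μ` (every certified grand-canonical
  CEILING is a canonical ceiling at every density; the number form of `SectorPartitionFnGrandCanonicalBound`);
* `gcPressureTT'_mono`, `gcPressureTT'_sub_le` (`2β`-Lipschitz), `convexOn_gcPressureTT'` — `μ ↦ P(μ)` is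
  nondecreasing, `2β`-Lipschitz and convex;
* **the inverse transform** (`β > 0`, `0 < n < 2`): `exists_chemicalPotential_pressureTT'_eq` — there is a chemical
  potential `μ` with `pressureTT' n = P(μ) − βμn` (the supporting line of the concave `pressureTT'` at `n`,
  `exists_supporting_line_pressureTT'`), hence `pressureTT'_eq_iInf_gcPressureTT'`:
  `pressureTT' n = inf_μ [P(μ) − βμn]` and `isGLB_pressureTT'` — the canonical number of record is RECOVERED from the
  grand-canonical pressure: the two ensembles carry the same information at every `T > 0`.

Everything is PROVED; no definition, no named fact.

## Mathlib / tree search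

REUSED: `gcPressureTT'_le_iff`, `pressureTT'_add_le_gcPressureTT'`, `bddAbove_legendreSet`
(`HubbardTTPrimeGrandCanonicalPressure`), `pressureTT'₂_le_pressureTT'` (`HubbardTTPrimeThermalPressureSpinSectorsConcave`),
`exists_supporting_line_pressureTT'` (`HubbardTTPrimeThermalPressureDensityAnchors`), Mathlib `csSup_le_iff`, `le_csSup`,
`exists_lt_of_lt_csSup`, `IsGLB.ciInf_eq`. `lean search 'gcPressureTT.*pressureTT'`: only the files above
(2026-08-27).

## References

* D. Ruelle, *Statistical Mechanics: Rigorous Results* (1969), §3.4 (equivalence of ensembles for lattice systems).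
  [cite: Ruelle1969, §3.4]
* R. B. Israel, *Convexity in the Theory of Lattice Gases* (1979), Thm. I.2.4. [cite: Israel1979, Thm. I.2.4]
-/

noncomputable section

namespace Literature.MathematicalPhysics.QuantumLattice

open Matrix Finset HubbardWave0 Literature.Probability.LatticeModels LiebThm1
open _root_.Filter
open scoped _root_.Topology ComplexOrder BigOperators

namespace ThermodynamicLimit

section Diagonal

variable {β : ℝ} (hβ : 0 ≤ β) (t t' : ℝ) {U : ℝ} (hU : 0 ≤ U) (μ : ℝ)
include hβ hU

/-- **The Legendre supremum collapses onto the diagonal**: `P(μ) ≤ q ↔ ∀ n ∈ [0,2), pressureTT' n + βμn ≤ q`.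
[cite: Ruelle1969, §3.4] -/
theorem gcPressureTT'_le_iff_pressureTT' {q : ℝ} :
    gcPressureTT' β t t' U μ ≤ q ↔ ∀ n : ℝ, 0 ≤ n → n < 2 → pressureTT' β t t' U n + β * μ * n ≤ q := by
  rw [gcPressureTT'_le_iff hβ t t' hU μ]
  constructor
  · intro h n hn0 hn2
    have h' := h (n / 2) (n / 2) (by linarith) (by linarith) (by linarith) (by linarith)
    rwa [pressureTT'₂_half_half hβ t t' hU hn0 hn2, show n / 2 + n / 2 = n by ring] at h'
  · intro h x y hx0 hx1 hy0 hy1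
    have h1 := pressureTT'₂_le_pressureTT' hβ t t' hU hx0 hx1 hy0 hy1
    have h2 := h (x + y) (by linarith) (by linarith)
    linarith

/-- The one-variable Legendre set is bounded above. [cite: Ruelle1969, §3.4] -/
theorem bddAbove_legendreSet_pressureTT' :
    BddAbove ((fun n : ℝ => pressureTT' β t t' U n + β * μ * n) '' Set.Ico (0 : ℝ) 2) := by
  refine ⟨gcPressureTT' β t t' U μ, ?_⟩
  rintro _ ⟨n, hn, rfl⟩
  exact pressureTT'_add_le_gcPressureTT' hβ t t' hU μ hn.1 hn.2

/-- **`P(μ)` is the least upper bound of `{pressureTT' n + βμn : n ∈ [0,2)}`.** [cite: Ruelle1969, §3.4] -/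
theorem isLUB_gcPressureTT' :
    IsLUB ((fun n : ℝ => pressureTT' β t t' U n + β * μ * n) '' Set.Ico (0 : ℝ) 2) (gcPressureTT' β t t' U μ) := by
  refine ⟨?_, ?_⟩
  · rintro _ ⟨n, hn, rfl⟩
    exact pressureTT'_add_le_gcPressureTT' hβ t t' hU μ hn.1 hn.2
  · intro q hq
    rw [gcPressureTT'_le_iff_pressureTT' hβ t t' hU μ]
    intro n hn0 hn2
    exact hq ⟨n, ⟨hn0, hn2⟩, rfl⟩

/-- **Equivalence of ensembles**: `P(β; t,t',U; μ) = sup_{n ∈ [0,2)} [pressureTT' β t t' U n + βμn]` — the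
grand-canonical pressure is the Legendre transform of the canonical `S^z = 0` pressure of record.
[cite: Ruelle1969, §3.4] [cite: Israel1979, Thm. I.2.4] -/
theorem gcPressureTT'_eq_sSup_pressureTT' :
    gcPressureTT' β t t' U μ = sSup ((fun n : ℝ => pressureTT' β t t' U n + β * μ * n) '' Set.Ico (0 : ℝ) 2) :=
  ((isLUB_gcPressureTT' hβ t t' hU μ).csSup_eq ⟨_, ⟨0, ⟨le_rfl, two_pos⟩, rfl⟩⟩).symm

/-- **How a grand-canonical floor becomes canonical information**: every `W < P(μ)` is exceeded by
`pressureTT' n + βμn` for some density `n ∈ [0,2)`. [cite: Ruelle1969, §3.4] -/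
theorem exists_pressureTT'_add_gt_of_lt_gcPressureTT' {W : ℝ} (hW : W < gcPressureTT' β t t' U μ) :
    ∃ n : ℝ, 0 ≤ n ∧ n < 2 ∧ W < pressureTT' β t t' U n + β * μ * n := by
  have hne : ((fun n : ℝ => pressureTT' β t t' U n + β * μ * n) '' Set.Ico (0 : ℝ) 2).Nonempty :=
    ⟨_, ⟨0, ⟨le_rfl, two_pos⟩, rfl⟩⟩
  rw [gcPressureTT'_eq_sSup_pressureTT' hβ t t' hU μ] at hW
  obtain ⟨_, ⟨n, hn, rfl⟩, hlt⟩ := exists_lt_of_lt_csSup hne hW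
  exact ⟨n, hn.1, hn.2, hlt⟩

/-- **Every grand-canonical ceiling is a canonical ceiling at every density**:
`pressureTT' β t t' U n ≤ P(μ) − βμn` for all real `μ` and `n ∈ [0,2)` (the number form of the Peierls bound
`e^{βμN} Z_N ≤ Ξ`). [cite: Ruelle1969, §3.4] -/
theorem pressureTT'_le_gcPressureTT'_sub {n : ℝ} (hn0 : 0 ≤ n) (hn2 : n < 2) :
    pressureTT' β t t' U n ≤ gcPressureTT' β t t' U μ - β * μ * n := by
  have h := pressureTT'_add_le_gcPressureTT' hβ t t' hU μ hn0 hn2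
  linarith

/-- **Grand-canonical certificates bound the canonical number**: if along some `Ls → ∞`, for every `ε > 0`
eventually `log Re Z_β(H_L − μN) ≤ (q + ε) L²`, then `pressureTT' β t t' U n ≤ q − βμn` for every `n ∈ [0,2)`; and if
eventually `(W − ε) L² ≤ log Re Z_β(H_L − μN)`, then for every `η > 0` some density `n ∈ [0,2)` has
`W − η < pressureTT' n + βμn`. [cite: Ruelle1969, §3.4] -/
theorem pressureTT'_bounds_of_grandCanonical_certificates {Ls : ℕ → ℕ} (hLs : Tendsto Ls atTop atTop)
    {q W : ℝ}
    (hq : ∀ ε : ℝ, 0 < ε → ∀ᶠ j in atTop,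
      Real.log (partitionFn β (hubbardRectTorusTT' (Ls j) (Ls j) t t' U - (μ : ℂ) • totalNumber)).re ≤
        (q + ε) * ((Ls j : ℕ) : ℝ) ^ 2)
    (hW : ∀ ε : ℝ, 0 < ε → ∀ᶠ j in atTop,
      (W - ε) * ((Ls j : ℕ) : ℝ) ^ 2 ≤
        Real.log (partitionFn β (hubbardRectTorusTT' (Ls j) (Ls j) t t' U - (μ : ℂ) • totalNumber)).re) :
    (∀ n : ℝ, 0 ≤ n → n < 2 → pressureTT' β t t' U n ≤ q - β * μ * n) ∧
      ∀ η : ℝ, 0 < η → ∃ n : ℝ, 0 ≤ n ∧ n < 2 ∧ W - η < pressureTT' β t t' U n + β * μ * n := by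
  have hup := gcPressureTT'_le_of_eventually hβ t t' hU μ hLs hq
  have hlo := le_gcPressureTT'_of_eventually hβ t t' hU μ hLs hW
  refine ⟨fun n hn0 hn2 => ?_, fun η hη => ?_⟩
  · have h := pressureTT'_le_gcPressureTT'_sub hβ t t' hU μ hn0 hn2
    linarith
  · exact exists_pressureTT'_add_gt_of_lt_gcPressureTT' hβ t t' hU μ (by linarith)

/-- **A chemical potential for every interior density** (`β > 0`, `0 < n < 2`): there is `μ` with
`pressureTT' β t t' U n = P(μ) − βμn` — the supporting line of the concave `pressureTT'` at `n` has slope `−βμ`, and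
along it the Legendre supremum is attained at `n`. [cite: Ruelle1969, §3.4] [cite: Israel1979, Thm. I.2.4] -/
theorem exists_chemicalPotential_pressureTT'_eq (hβ' : 0 < β) {n : ℝ} (hn0 : 0 < n) (hn2 : n < 2) :
    ∃ μ₀ : ℝ, pressureTT' β t t' U n = gcPressureTT' β t t' U μ₀ - β * μ₀ * n := by
  obtain ⟨s, hs⟩ := exists_supporting_line_pressureTT' hβ t t' hU hn0 hn2
  refine ⟨-s / β, le_antisymm ?_ ?_⟩
  · have h := pressureTT'_le_gcPressureTT'_sub hβ t t' hU (-s / β) hn0.le hn2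
    exact h
  · -- `P(−s/β) ≤ p(n) − s n`: every density term lies under the supporting line
    have hP : gcPressureTT' β t t' U (-s / β) ≤ pressureTT' β t t' U n - s * n := by
      rw [gcPressureTT'_le_iff_pressureTT' hβ t t' hU]
      intro x hx0 hx2
      have hx := hs x ⟨hx0, hx2⟩
      have e : β * (-s / β) * x = -(s * x) := by field_simp
      rw [e]
      linarith
    have e : β * (-s / β) * n = -(s * n) := by field_simp
    rw [e]
    linarith

/-- Every `P(μ) − βμn` is an upper bound and they approach `pressureTT' n`: the set `{P(μ) − βμn : μ ∈ ℝ}` has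
`pressureTT' β t t' U n` as greatest lower bound (`β > 0`, `0 < n < 2`). [cite: Ruelle1969, §3.4] -/
theorem isGLB_pressureTT' (hβ' : 0 < β) {n : ℝ} (hn0 : 0 < n) (hn2 : n < 2) :
    IsGLB (Set.range fun μ₀ : ℝ => gcPressureTT' β t t' U μ₀ - β * μ₀ * n) (pressureTT' β t t' U n) := by
  refine ⟨?_, ?_⟩
  · rintro _ ⟨μ₀, rfl⟩
    exact pressureTT'_le_gcPressureTT'_sub hβ t t' hU μ₀ hn0.le hn2
  · intro b hb
    obtain ⟨μ₀, hμ₀⟩ := exists_chemicalPotential_pressureTT'_eq hβ t t' hU hβ' hn0 hn2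
    rw [hμ₀]
    exact hb ⟨μ₀, rfl⟩

/-- **Equivalence of ensembles, inverse direction**: `pressureTT' β t t' U n = inf_μ [P(β; t,t',U; μ) − βμn]`
(`β > 0`, `U ≥ 0`, `0 < n < 2`) — the canonical `S^z = 0` free entropy of record is the Legendre transform of the
grand-canonical pressure. [cite: Ruelle1969, §3.4] [cite: Israel1979, Thm. I.2.4] -/
theorem pressureTT'_eq_iInf_gcPressureTT' (hβ' : 0 < β) {n : ℝ} (hn0 : 0 < n) (hn2 : n < 2) :
    pressureTT' β t t' U n = ⨅ μ₀ : ℝ, (gcPressureTT' β t t' U μ₀ - β * μ₀ * n) :=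
  (isGLB_pressureTT' hβ t t' hU hβ' hn0 hn2).ciInf_eq.symm

/-- **`P` is nondecreasing in the chemical potential** (`β ≥ 0`). [cite: Ruelle1969, §3.4] -/
theorem gcPressureTT'_mono {μ₁ μ₂ : ℝ} (hμ : μ₁ ≤ μ₂) :
    gcPressureTT' β t t' U μ₁ ≤ gcPressureTT' β t t' U μ₂ := by
  rw [gcPressureTT'_le_iff_pressureTT' hβ t t' hU]
  intro n hn0 hn2
  have h := pressureTT'_add_le_gcPressureTT' hβ t t' hU μ₂ hn0 hn2
  have : β * μ₁ * n ≤ β * μ₂ * n := by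
    have := mul_le_mul_of_nonneg_left hμ hβ
    exact mul_le_mul_of_nonneg_right this hn0
  linarith

/-- **`P` is `2β`-Lipschitz in the chemical potential**: `P(μ₂) − P(μ₁) ≤ 2β(μ₂ − μ₁)` for `μ₁ ≤ μ₂` (the density is at
most `2`). [cite: Ruelle1969, §3.4] -/
theorem gcPressureTT'_sub_le {μ₁ μ₂ : ℝ} (hμ : μ₁ ≤ μ₂) :
    gcPressureTT' β t t' U μ₂ - gcPressureTT' β t t' U μ₁ ≤ 2 * β * (μ₂ - μ₁) := by
  suffices h : gcPressureTT' β t t' U μ₂ ≤ gcPressureTT' β t t' U μ₁ + 2 * β * (μ₂ - μ₁) by linarith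
  rw [gcPressureTT'_le_iff_pressureTT' hβ t t' hU]
  intro n hn0 hn2
  have h := pressureTT'_add_le_gcPressureTT' hβ t t' hU μ₁ hn0 hn2
  have : β * μ₂ * n ≤ β * μ₁ * n + 2 * β * (μ₂ - μ₁) := by
    have h1 : β * (μ₂ - μ₁) * n ≤ β * (μ₂ - μ₁) * 2 :=
      mul_le_mul_of_nonneg_left hn2.le (mul_nonneg hβ (sub_nonneg.2 hμ))
    linarith
  linarith

/-- **`P` is convex in the chemical potential** (a supremum of affine functions). [cite: Ruelle1969, §3.4] -/
theorem convexOn_gcPressureTT' : ConvexOn ℝ Set.univ (gcPressureTT' β t t' U) := by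
  refine ⟨convex_univ, ?_⟩
  intro μ₁ _ μ₂ _ θ θ' hθ hθ' hθθ'
  simp only [smul_eq_mul]
  rw [gcPressureTT'_le_iff_pressureTT' hβ t t' hU]
  intro n hn0 hn2
  have h1 := pressureTT'_add_le_gcPressureTT' hβ t t' hU μ₁ hn0 hn2
  have h2 := pressureTT'_add_le_gcPressureTT' hβ t t' hU μ₂ hn0 hn2
  have e : pressureTT' β t t' U n + β * (θ * μ₁ + θ' * μ₂) * n =
      θ * (pressureTT' β t t' U n + β * μ₁ * n) + θ' * (pressureTT' β t t' U n + β * μ₂ * n) := by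
    have hθ'' : θ' = 1 - θ := by linarith
    rw [hθ'']
    ring
  nlinarith [mul_le_mul_of_nonneg_left h1 hθ, mul_le_mul_of_nonneg_left h2 hθ', hθθ']

end Diagonal

end ThermodynamicLimit

end Literature.MathematicalPhysics.QuantumLattice
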